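import Summits.AtomisticToContinuum.BoseEinsteinCondensation.Theorems.BECTangentRigidityRigidMomentumBoundStubInsertionBound
import Literature.MathematicalPhysics.QuantumManyBody.BoseGasInsertionScaling
import HarnessLib

/-!
# Crux `GroundStateRigidity` (stmt-AtomisticToContinuum-9072), line `Sketch`:
# the registered stub `stub_insertionWindow` (Stub B)

Supports (does not close) stmt-AtomisticToContinuum-9072; registered stub `stub_insertionWindow`
(Stub B) of line Sketch, skeleton v9 (lead c5). **Bosonic insertion window (chemical potential at
low density).** There is an absolute `A > 0` (here `A = 8`) such that for `n ≥ 1` bosons in the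
Dirichlet box `Λ_L`, a measurable pair profile `v ≥ 0` of range `R ≥ 0` (`v = 0` beyond `R`, anything —
`⊤` included — below) and a length `ℓ > R` with `2000 n ℓ³ ≤ L³`:
`E₀(n+1, L) ≤ E₀(n, L) + A/ℓ²`.

## Proof

A corollary of the tree's landed chemical-potential bound for the crux `RigidMomentumBound`:
`RigidMomentumBound.insertionBound_range_two` (range `2`, Dyson's Jastrow-dressed insertion,
LSSY2005 Thm 2.2) rescaled to the range `ℓ` by the exact dilation covariance
`InsertionScaling.insertionBound_of_fixedRange` gives
`E₀(n+1, L) ≤ E₀(n, L) + 120/L² + 13000·n·ℓ/L³` whenever `v = 0` beyond `ℓ` and `n ℓ³ ≤ L³/2000`.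
With `2000 n ℓ³ ≤ L³` and `n ≥ 1` one has `L³ ≥ 2000 ℓ³ > (12ℓ)³`, so `L ≥ 12ℓ` and
`120/L² ≤ 120/(144ℓ²) ≤ 1/ℓ²`, while `13000 n ℓ/L³ ≤ 13000 n ℓ/(2000 n ℓ³) ≤ 7/ℓ²`; total `≤ 8/ℓ²`.
-/

noncomputable section

open MeasureTheory Filter Metric
open scoped ENNReal NNReal Topology

namespace Summit.AtomisticToContinuum.BoseEinsteinCondensation.Theorems.GroundStateRigidity

open Literature.MathematicalPhysics.QuantumManyBody.BoseGas

namespace InsertionWindow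

/-- The chemical-potential bound at an arbitrary range `ℓ > 0`: if `v = 0` beyond `ℓ`, `L > 0` and
`n ℓ³ ≤ L³/2000`, then `E₀(n+1, L) ≤ E₀(n, L) + 120/L² + 13000·n·ℓ/L³`
(`RigidMomentumBound.InsertionBound.insertionBound_range_two` rescaled by
`InsertionScaling.insertionBound_of_fixedRange`). [cite: LSSY2005, Thm 2.2 (2.17)–(2.26)] -/
theorem insertionBound_range {v : ℝ → ℝ≥0∞} (hv : Measurable v) {ℓ : ℝ} (hℓ : 0 < ℓ)
    (hvℓ : ∀ r, ℓ < r → v r = 0) (n : ℕ) {L : ℝ} (hL : 0 < L)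
    (hnL : (n : ℝ) * ℓ ^ 3 ≤ L ^ 3 / 2000) :
    groundStateEnergy v (n + 1) L ≤
      groundStateEnergy v n L + ENNReal.ofReal (120 / L ^ 2 + 13000 * n * ℓ / L ^ 3) :=
  InsertionScaling.insertionBound_of_fixedRange (c := 2) (A := 120) (B := 13000) two_pos
    (fun v hv hv2 N L hL hNL =>
      RigidMomentumBound.InsertionBound.insertionBound_range_two v hv hv2 N L hL hNL)
    hv hℓ hvℓ n hL hnL

/-- The numerical step: for `n ≥ 1`, `0 < ℓ`, `0 < L` and `2000 n ℓ³ ≤ L³`,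
`120/L² + 13000·n·ℓ/L³ ≤ 8/ℓ²` (`L ≥ 12 ℓ` as `12³ = 1728 ≤ 2000`). [folklore] -/
theorem numeric_bound {n : ℕ} {ℓ L : ℝ} (hn : 1 ≤ n) (hℓ : 0 < ℓ) (hL : 0 < L)
    (hnL : 2000 * (n : ℝ) * ℓ ^ 3 ≤ L ^ 3) :
    120 / L ^ 2 + 13000 * n * ℓ / L ^ 3 ≤ 8 / ℓ ^ 2 := by
  have hn1 : (1 : ℝ) ≤ n := by exact_mod_cast hn
  have hℓ2 : 0 < ℓ ^ 2 := by positivity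
  have hℓ3 : 0 < ℓ ^ 3 := by positivity
  have hL3 : 0 < L ^ 3 := by positivity
  -- `L ≥ 12 ℓ`
  have hcube : (12 * ℓ) ^ 3 ≤ L ^ 3 := by nlinarith
  have h12 : 12 * ℓ ≤ L := le_of_pow_le_pow_left₀ (by norm_num) hL.le hcube
  have hsq : 144 * ℓ ^ 2 ≤ L ^ 2 := by nlinarith
  have hA : 120 / L ^ 2 ≤ 1 / ℓ ^ 2 := by
    rw [div_le_div_iff₀ (by positivity) hℓ2]
    nlinarith
  have hB : 13000 * n * ℓ / L ^ 3 ≤ 7 / ℓ ^ 2 := by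
    rw [div_le_div_iff₀ hL3 hℓ2]
    have h0 : (0 : ℝ) ≤ n * ℓ ^ 3 := by positivity
    nlinarith
  calc 120 / L ^ 2 + 13000 * n * ℓ / L ^ 3 ≤ 1 / ℓ ^ 2 + 7 / ℓ ^ 2 := add_le_add hA hB
    _ = 8 / ℓ ^ 2 := by ring

end InsertionWindow

open InsertionWindow in
/-- **Stub B `stub_insertionWindow` of the line `Sketch` (skeleton v9) of the crux
`GroundStateRigidity` — bosonic insertion bound (chemical-potential window).** There is an absolute
`A > 0` such that for `n ≥ 1` bosons in the Dirichlet box `Λ_L`, a measurable repulsive pair profile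
`v` of range `R` (`v = 0` beyond `R`; `⊤` allowed below), and a length `ℓ > R` with
`2000 n ℓ³ ≤ L³`: `E₀(n+1, L) ≤ E₀(n, L) + A/ℓ²`. Corollary of the tree's chemical-potential bound
`RigidMomentumBound.insertionBound_range_two` (Dyson's Jastrow-dressed insertion) rescaled to the
range `ℓ` by `InsertionScaling.insertionBound_of_fixedRange`, and the arithmetic
`120/L² + 13000·n·ℓ/L³ ≤ 8/ℓ²` under `2000 n ℓ³ ≤ L³`, `n ≥ 1`.
[cite: LSSY2005, Thm 2.2 (2.17)–(2.26)] -/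
theorem stub_insertionWindow :
    ∃ A : ℝ, 0 < A ∧ ∀ (n : ℕ) (L R ℓ : ℝ) (v : ℝ → ℝ≥0∞), 1 ≤ n → 0 < L → Measurable v →
      0 ≤ R → R < ℓ → (∀ r : ℝ, R < r → v r = 0) → 2000 * (n : ℝ) * ℓ ^ 3 ≤ L ^ 3 →
      groundStateEnergy v (n + 1) L ≤ groundStateEnergy v n L + ENNReal.ofReal (A / ℓ ^ 2) := by
  refine ⟨8, by norm_num, fun n L R ℓ v hn hL hv hR hRℓ hvR hnL => ?_⟩
  have hℓ : 0 < ℓ := hR.trans_lt hRℓ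
  have hvℓ : ∀ r, ℓ < r → v r = 0 := fun r hr => hvR r (hRℓ.trans hr)
  have hnL' : (n : ℝ) * ℓ ^ 3 ≤ L ^ 3 / 2000 := by
    rw [le_div_iff₀ (by norm_num : (0 : ℝ) < 2000)]
    linarith
  exact (insertionBound_range hv hℓ hvℓ n hL hnL').trans
    (add_le_add_right (ENNReal.ofReal_le_ofReal (numeric_bound hn hℓ hL hnL)) _)

end Summit.AtomisticToContinuum.BoseEinsteinCondensation.Theorems.GroundStateRigidity

end
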